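import Summits.CriticalPhenomena.CardyFormulaZ2.Theorems.CardyBoundaryCoulombGasHalfPlaneMarkDensityLawBlockSelect
import Summits.CriticalPhenomena.CardyFormulaZ2.Theorems.CardyBoundaryCoulombGasHalfPlaneMarkDensityLawLegFactorHalf
import Literature.Probability.Percolation.Z2HalfPlaneThreeArm
import Literature.Probability.Percolation.PlanarDuality
import Literature.Probability.Percolation.RSW
import Literature.Probability.Percolation.SiteMonotonicity
import Literature.Probability.Percolation.CornerPercolation
import Literature.Probability.Percolation.HalfSpacePinnedPairs

/-!
# Self-duality of the half-plane arc-crossing function of bond-`ℤ²`, part 6a: few touches, the union bound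

Support file for the crux `HalfPlaneMarkDensityLaw` (stmt-CriticalPhenomena-5661), line `Sketch`
(a-priori structure of the open stub C⁺: self-duality, Stage II — bottom-row insensitivity).
The BULK "few touches" event — some boundary site `(t,0)` of the zone `[z₀,z₁]×{0}`, at distance
`≥ ℓ` from its ends, is joined inside `H` to a far set `F` while its `H`-cluster has at most `M`
boundary sites ("touches") in the zone, all at distance `≥ ℓ` from the ends — is covered, via the
combinatorial block selection `block_select` (scales `s₀ ≥ s₁ ≥ ⋯`), by the LEVEL events
`Φ_j(t)`: the least touch `t` of the cluster starts a block `[t, t']` of diameter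
`≤ D_j = M (s_{j+1} + 1)` followed by a touch-free stretch of length `s_j` (registered stub
`bulk_cover`).  Given the isolated-block lemma (part 5d, `isoBlock_threeArm`, taken here as the
hypothesis `hiso` so that this file does not wait for that one), `Φ_j(t) ∩ {leg t open}` lies in
the library's half-plane three-arm event of the grid window of `t` (size `2D_j + 2`, scale
`s_j − 1`; `phi_leg_subset_threeArm`), and the fixed-scale union bound follows:

  `P(Bulk) ≤ ∑_{j ≤ M} 2 ∑_{g} P(threeArm (G_j g − 1) (2D_j + 2) (s_j − 1))`,  `G_j = D_j + 1`,

`g` over the grid windows meeting the zone (`measureReal_bulk_le`): each level event is split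
according to its least anchor `t`, the factor `2` pays for opening the leg at `t`
(`leg_factor_half`; the level events are determined by the half-plane edges). The scales are chosen
in part 6b.
-/

noncomputable section

namespace Summit.CriticalPhenomena.CardyFormulaZ2.Cruxes.HalfPlaneMarkDensityLaw.SketchLine.SelfDual

open Literature.Probability.Percolation Literature.Probability.LatticeModels
open Literature.Probability.Percolation.Z2HalfPlane (leg adj_leg threeArm)
open MeasureTheory Filter Set SimpleGraph
open Summit.CriticalPhenomena.CardyFormulaZ2.Theorems.HalfPlaneMarkDensityLaw.Negative

/-! ### Windows -/

/-- The three-arm event is monotone in its boundary window: `[j, j+m) ⊆ [j', j'+m')` gives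
`threeArm j m R ⊆ threeArm j' m' R`. [cite: LawlerSchrammWernerEJP2002, Appendix A] -/
theorem threeArm_window_mono {j j' : ℤ} {m m' : ℕ} (h1 : j' ≤ j) (h2 : j + m ≤ j' + m') (R : ℕ) :
    threeArm j m R ⊆ threeArm j' m' R := by
  rintro ω ⟨a, b, ⟨ha1, ha2, hb1, hb2⟩, hleg, v, P, hfar, hP, hPω, g, Q, hgfar, hQ, hQω, a', ⟨ha'1, ha'2⟩,
    hrest⟩
  exact ⟨a, b, ⟨by omega, by omega, by omega, by omega⟩, hleg, v, P, hfar, hP, hPω, g, Q, hgfar, hQ, hQω,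
    a', ⟨by omega, by omega⟩, hrest⟩

/-- The boundary site `(k,0)` lies in `H`. [folklore] -/
theorem bpt_mem_halfPlane (k : ℤ) : bpt k ∈ halfPlane := by
  simp [bpt, halfPlane]

/-! ### The level event `Φ_j(t)` and the three arms -/

/-- **Level event with an open leg ⇒ three arms from a grid window.**  On
`Φ(t) = {∃ t' ∈ [t, t+D] : z₀+ℓ ≤ t, t' ≤ z₁−ℓ, (t,0) ↔ F in H, every zone touch u of the
H-cluster of (t,0) has t ≤ u and (u ≤ t' or u ≥ t'+θ)}` with the leg at `t` open, scales
`D + 4 ≤ s ≤ ℓ`, `s + 1 ≤ θ` and a far set `F` (every `f ∈ F` has `|f₀ − t| ≥ 3ℓ` or `f₁ ≥ 3ℓ`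
for all `t` in the zone), the configuration lies in
`threeArm (G ⌊t/G⌋ − 1) (2D+2) (s−1)`, `G = D+1` (the isolated-block lemma `hiso` + `threeArm_window_mono`).
[cite: LawlerSchrammWernerEJP2002, Appendix A] -/
theorem phi_leg_subset_threeArm
    (hiso : ∀ {ω : BondConfig (Site 2)}, ω ⊆ (zdGraph 2).edgeSet → ∀ (t t' : ℤ) (s : ℕ), t ≤ t' → t' - t + 4 ≤ s → (∃ v : Site 2, (t' - t + 2 * s ≤ |v 0 - t| ∨ t' - t + 2 * s ≤ v 1) ∧ ω ∈ openConnIn halfPlane (bpt t) v) → (∀ u : ℤ, (t - s ≤ u ∧ u < t) ∨ (t' < u ∧ u ≤ t' + s) → ω ∉ openConnIn halfPlane (bpt t) (bpt u)) → leg t ∈ ω → ω ∈ Z2HalfPlane.threeArm (t - 1) (t' - t + 2).toNat (s - 1))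
    {ω : BondConfig (Site 2)} (hω : ω ⊆ (zdGraph 2).edgeSet)
    {z₀ z₁ ℓ : ℤ} {F : Set (Site 2)} {D s : ℕ} {θ t : ℤ}
    (hDs : (D : ℤ) + 4 ≤ s) (hsℓ : (s : ℤ) ≤ ℓ) (hθ : (s : ℤ) + 1 ≤ θ)
    (hF : ∀ f ∈ F, ∀ t : ℤ, z₀ ≤ t → t ≤ z₁ → 3 * ℓ ≤ |f 0 - t| ∨ 3 * ℓ ≤ f 1)
    (hΦ : ω ∈ {ω : BondConfig (Site 2) | ∃ t' : ℤ, t ≤ t' ∧ t' ≤ t + D ∧ z₀ + ℓ ≤ t ∧ t' ≤ z₁ - ℓ ∧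
      ω ∈ openCrossing halfPlane {bpt t} F ∧ ∀ u : ℤ, z₀ ≤ u → u ≤ z₁ →
        ω ∈ openConnIn halfPlane (bpt t) (bpt u) → t ≤ u ∧ (u ≤ t' ∨ t' + θ ≤ u)})
    (hleg : leg t ∈ ω) :
    ω ∈ threeArm (((D : ℤ) + 1) * (t / ((D : ℤ) + 1)) - 1) (2 * D + 2) (s - 1) := by
  obtain ⟨t', htt', ht'D, hzt, ht'z, hcross, hall⟩ := hΦ
  have hfar : ∃ v : Site 2, (t' - t + 2 * s ≤ |v 0 - t| ∨ t' - t + 2 * s ≤ v 1) ∧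
      ω ∈ openConnIn halfPlane (bpt t) v := by
    simp only [mem_openCrossing_iff, Set.mem_singleton_iff, exists_eq_left] at hcross
    obtain ⟨f, hf, hconn⟩ := hcross
    refine ⟨f, ?_, hconn⟩
    rcases hF f hf t (by omega) (by omega) with h | h
    · left; omega
    · right; omega
  have hfree : ∀ u : ℤ, (t - s ≤ u ∧ u < t) ∨ (t' < u ∧ u ≤ t' + s) →
      ω ∉ openConnIn halfPlane (bpt t) (bpt u) := by
    intro u hu hconn
    rcases hu with ⟨hu1, hu2⟩ | ⟨hu1, hu2⟩
    · have := (hall u (by omega) (by omega) hconn).1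
      omega
    · rcases (hall u (by omega) (by omega) hconn).2 with h | h <;> omega
  have key := hiso hω t t' s htt' (by omega) hfar hfree hleg
  have hG : ((D : ℤ) + 1) * (t / ((D : ℤ) + 1)) ≤ t ∧ t < ((D : ℤ) + 1) * (t / ((D : ℤ) + 1)) + ((D : ℤ) + 1) := by
    have h1 := Int.mul_ediv_add_emod t ((D : ℤ) + 1)
    have h2 := Int.emod_nonneg t (by positivity : (D : ℤ) + 1 ≠ 0)
    have h3 := Int.emod_lt_of_pos t (by positivity : (0 : ℤ) < (D : ℤ) + 1)
    constructor <;> omega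
  refine threeArm_window_mono ?_ ?_ (s - 1) key
  · exact by omega
  · rw [Int.toNat_of_nonneg (by omega)]
    push_cast
    omega

/-! ### Covering the bulk few-touches event by the level events -/

/-- **Block selection on the touch set.**  With scales `s₀ ≥ s₁ ≥ ⋯` (block diameters
`D_{j+1} = M (s_{j+1}+1)`, gaps `θ_j = s_j + 1`), the bulk few-touches event is covered by the level
events `Φ_j(t)`, `j ≤ M`, `t ∈ ℤ`: apply `block_select` to the (finite, nonempty, `≤ M`-element)
set of zone touches of the cluster and re-anchor at its least element. [folklore] -/
theorem bulk_subset_iUnion_phi (M : ℕ) (s : ℕ → ℕ) (hs : ∀ j, s (j + 1) ≤ s j) {z₀ z₁ ℓ : ℤ}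
    (hℓ : 0 ≤ ℓ) (F : Set (Site 2)) :
    {ω : BondConfig (Site 2) | ∃ t : ℤ, z₀ + ℓ ≤ t ∧ t ≤ z₁ - ℓ ∧ ω ∈ openCrossing halfPlane {bpt t} F ∧
      (∀ u : ℤ, z₀ ≤ u → u ≤ z₁ → ω ∈ openConnIn halfPlane (bpt t) (bpt u) → z₀ + ℓ ≤ u ∧ u ≤ z₁ - ℓ) ∧
      {u : ℤ | z₀ ≤ u ∧ u ≤ z₁ ∧ ω ∈ openConnIn halfPlane (bpt t) (bpt u)}.ncard ≤ M} ⊆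
    ⋃ j ∈ Finset.range (M + 1), ⋃ t : ℤ,
      {ω : BondConfig (Site 2) | ∃ t' : ℤ, t ≤ t' ∧ t' ≤ t + (M * (s (j + 1) + 1) : ℕ) ∧ z₀ + ℓ ≤ t ∧
        t' ≤ z₁ - ℓ ∧ ω ∈ openCrossing halfPlane {bpt t} F ∧ ∀ u : ℤ, z₀ ≤ u → u ≤ z₁ →
          ω ∈ openConnIn halfPlane (bpt t) (bpt u) → t ≤ u ∧ (u ≤ t' ∨ t' + ((s j : ℤ) + 1) ≤ u)} := by
  classical
  rintro ω ⟨t₀, ht₀l, ht₀r, hcross, hbulk, hcard⟩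
  set Tset : Set ℤ := {u : ℤ | z₀ ≤ u ∧ u ≤ z₁ ∧ ω ∈ openConnIn halfPlane (bpt t₀) (bpt u)} with hTset
  have hfin : Tset.Finite := (Set.finite_Icc z₀ z₁).subset fun u hu => ⟨hu.1, hu.2.1⟩
  set T : Finset ℤ := hfin.toFinset with hT
  have hmemT : ∀ u, u ∈ T ↔ z₀ ≤ u ∧ u ≤ z₁ ∧ ω ∈ openConnIn halfPlane (bpt t₀) (bpt u) := fun u => by
    rw [hT, Set.Finite.mem_toFinset, hTset, Set.mem_setOf_eq]
  have ht₀T : t₀ ∈ T := (hmemT t₀).2 ⟨by omega, by omega, openConnIn_refl (bpt_mem_halfPlane t₀)⟩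
  have hTne : T.Nonempty := ⟨t₀, ht₀T⟩
  have hTcard : T.card ≤ M + 1 := by
    have : T.card = Tset.ncard := (Set.ncard_eq_toFinset_card Tset hfin).symm
    omega
  obtain ⟨j, hjM, t', ht'T, hdiff, hgap⟩ := block_select M (fun j => (s j : ℤ) + 1)
    (fun j => ((M * (s j + 1) : ℕ) : ℤ)) (fun j => by have := hs j; omega)
    (fun j => by positivity) (fun j => by push_cast; exact le_rfl) T hTne hTcard
  set tm := T.min' hTne with htm
  have htmT : tm ∈ T := Finset.min'_mem T hTne
  obtain ⟨htm0, htm1, htmconn⟩ := (hmemT tm).1 htmT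
  obtain ⟨ht'0, ht'1, ht'conn⟩ := (hmemT t').1 ht'T
  have hconn_tm : ∀ u : ℤ, ω ∈ openConnIn halfPlane (bpt tm) (bpt u) →
      ω ∈ openConnIn halfPlane (bpt t₀) (bpt u) := fun u hu =>
    PlanarDuality.openConnIn_trans htmconn hu
  refine Set.mem_iUnion₂.2 ⟨j, Finset.mem_range.2 (by omega), Set.mem_iUnion.2 ⟨tm, t', ?_, ?_, ?_, ?_, ?_, ?_⟩⟩
  · exact Finset.min'_le T t' ht'T
  · omega
  · exact (hbulk tm htm0 htm1 htmconn).1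
  · exact (hbulk t' ht'0 ht'1 ht'conn).2
  · simp only [mem_openCrossing_iff, Set.mem_singleton_iff, exists_eq_left] at hcross ⊢
    obtain ⟨f, hf, hf'⟩ := hcross
    refine ⟨f, hf, PlanarDuality.openConnIn_trans ?_ hf'⟩
    rw [openConnIn_comm]; exact htmconn
  · intro u hu0 hu1 hu
    have huT : u ∈ T := (hmemT u).2 ⟨hu0, hu1, hconn_tm u hu⟩
    refine ⟨Finset.min'_le T u huT, ?_⟩
    by_cases h : t' < u
    · right; have := hgap u huT h; omega
    · left; omega

/-- **Cover of the bulk few-touches event by the level events, registered form** (stub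
`bulk_cover`) of `bulk_subset_iUnion_phi`. [folklore] -/
theorem bulk_cover : ∀ (M : ℕ) (s : ℕ → ℕ), (∀ j, s (j + 1) ≤ s j) → ∀ {z₀ z₁ ℓ : ℤ}, 0 ≤ ℓ → ∀ (F : Set (Site 2)), {ω : BondConfig (Site 2) | ∃ t : ℤ, z₀ + ℓ ≤ t ∧ t ≤ z₁ - ℓ ∧ ω ∈ openCrossing halfPlane {bpt t} F ∧ (∀ u : ℤ, z₀ ≤ u → u ≤ z₁ → ω ∈ openConnIn halfPlane (bpt t) (bpt u) → z₀ + ℓ ≤ u ∧ u ≤ z₁ - ℓ) ∧ {u : ℤ | z₀ ≤ u ∧ u ≤ z₁ ∧ ω ∈ openConnIn halfPlane (bpt t) (bpt u)}.ncard ≤ M} ⊆ ⋃ j ∈ Finset.range (M + 1), ⋃ t : ℤ, {ω : BondConfig (Site 2) | ∃ t' : ℤ, t ≤ t' ∧ t' ≤ t + (M * (s (j + 1) + 1) : ℕ) ∧ z₀ + ℓ ≤ t ∧ t' ≤ z₁ - ℓ ∧ ω ∈ openCrossing halfPlane {bpt t} F ∧ ∀ u : ℤ, z₀ ≤ u → u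 ≤ z₁ → ω ∈ openConnIn halfPlane (bpt t) (bpt u) → t ≤ u ∧ (u ≤ t' ∨ t' + ((s j : ℤ) + 1) ≤ u)} :=
  fun M s hs _ _ _ hℓ F => bulk_subset_iUnion_phi M s hs hℓ F


/-! ### Locality and measurability of the level events -/

/-- Configurations agreeing on the half-plane edges have the same `H`-connections. [folklore] -/
theorem openConnIn_halfPlane_congr {ω ω' : BondConfig (Site 2)}
    (h : ω ∩ Z2HalfPlane.hpEdges = ω' ∩ Z2HalfPlane.hpEdges) (x y : Site 2) :
    ω ∈ openConnIn halfPlane x y ↔ ω' ∈ openConnIn halfPlane x y := by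
  have key : (openGraph ω).induce halfPlane = (openGraph ω').induce halfPlane := by
    ext u v
    simp only [SimpleGraph.comap_adj, Function.Embedding.coe_subtype, openGraph_adj]
    have hmem : s(u.1, v.1) ∈ Z2HalfPlane.hpEdges := by
      intro w hw
      rcases Sym2.mem_iff.1 hw with rfl | rfl
      · exact u.2
      · exact v.2
    have hiff : s(u.1, v.1) ∈ ω ↔ s(u.1, v.1) ∈ ω' :=
      ⟨fun h1 => ((Set.ext_iff.1 h _).1 ⟨h1, hmem⟩).1, fun h1 => ((Set.ext_iff.1 h _).2 ⟨h1, hmem⟩).1⟩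
    rw [hiff]
  simp only [openConnIn, Set.mem_setOf_eq, key]

/-- The level event `Φ(t)` is determined by the half-plane edges. [folklore] -/
theorem determinedBy_phi (z₀ z₁ ℓ : ℤ) (F : Set (Site 2)) (D : ℕ) (θ t : ℤ) :
    DeterminedBy {ω : BondConfig (Site 2) | ∃ t' : ℤ, t ≤ t' ∧ t' ≤ t + D ∧ z₀ + ℓ ≤ t ∧ t' ≤ z₁ - ℓ ∧
      ω ∈ openCrossing halfPlane {bpt t} F ∧ ∀ u : ℤ, z₀ ≤ u → u ≤ z₁ →
        ω ∈ openConnIn halfPlane (bpt t) (bpt u) → t ≤ u ∧ (u ≤ t' ∨ t' + θ ≤ u)} Z2HalfPlane.hpEdges := by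
  rw [determinedBy_iff]
  intro ω ω' h
  have key := openConnIn_halfPlane_congr h
  simp only [Set.mem_setOf_eq, mem_openCrossing_iff, key]

/-- The level event `Φ(t)` is measurable. [folklore] -/
theorem measurableSet_phi (z₀ z₁ ℓ : ℤ) (F : Set (Site 2)) (D : ℕ) (θ t : ℤ) :
    MeasurableSet {ω : BondConfig (Site 2) | ∃ t' : ℤ, t ≤ t' ∧ t' ≤ t + D ∧ z₀ + ℓ ≤ t ∧ t' ≤ z₁ - ℓ ∧
      ω ∈ openCrossing halfPlane {bpt t} F ∧ ∀ u : ℤ, z₀ ≤ u → u ≤ z₁ →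
        ω ∈ openConnIn halfPlane (bpt t) (bpt u) → t ≤ u ∧ (u ≤ t' ∨ t' + θ ≤ u)} := by
  refine measurableSet_setOf.2 (Measurable.exists fun t' => ?_)
  refine measurable_const.and (measurable_const.and (measurable_const.and (measurable_const.and
    (Measurable.and ?_ (Measurable.forall fun u => measurable_const.imp (measurable_const.imp
      (Measurable.imp ?_ measurable_const)))))))
  · exact measurable_mem.2 (measurableSet_openCrossing_of_countable _ _ _)
  · exact measurable_mem.2 (measurableSet_openConnIn_of_countable _ _ _)

/-! ### The union bound -/

/-- **Fixed-scale bound for the bulk few-touches event** (given the isolated-block lemma `hiso`).  See the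
module docstring.
[cite: LawlerSchrammWernerEJP2002, Appendix A] -/
theorem measureReal_bulk_le
    (hiso : ∀ {ω : BondConfig (Site 2)}, ω ⊆ (zdGraph 2).edgeSet → ∀ (t t' : ℤ) (s : ℕ), t ≤ t' → t' - t + 4 ≤ s → (∃ v : Site 2, (t' - t + 2 * s ≤ |v 0 - t| ∨ t' - t + 2 * s ≤ v 1) ∧ ω ∈ openConnIn halfPlane (bpt t) v) → (∀ u : ℤ, (t - s ≤ u ∧ u < t) ∨ (t' < u ∧ u ≤ t' + s) → ω ∉ openConnIn halfPlane (bpt t) (bpt u)) → leg t ∈ ω → ω ∈ Z2HalfPlane.threeArm (t - 1) (t' - t + 2).toNat (s - 1))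
    (M : ℕ) (s : ℕ → ℕ) (hs : ∀ j, s (j + 1) ≤ s j)
    (h1 : ∀ j, j ≤ M → M * (s (j + 1) + 1) + 4 ≤ s j) {z₀ z₁ ℓ : ℤ} (hℓ : (s 0 : ℤ) ≤ ℓ)
    (F : Set (Site 2)) (hF : ∀ f ∈ F, ∀ t : ℤ, z₀ ≤ t → t ≤ z₁ → 3 * ℓ ≤ |f 0 - t| ∨ 3 * ℓ ≤ f 1) :
    μ.real {ω : BondConfig (Site 2) | ∃ t : ℤ, z₀ + ℓ ≤ t ∧ t ≤ z₁ - ℓ ∧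
        ω ∈ openCrossing halfPlane {bpt t} F ∧
        (∀ u : ℤ, z₀ ≤ u → u ≤ z₁ → ω ∈ openConnIn halfPlane (bpt t) (bpt u) → z₀ + ℓ ≤ u ∧ u ≤ z₁ - ℓ) ∧
        {u : ℤ | z₀ ≤ u ∧ u ≤ z₁ ∧ ω ∈ openConnIn halfPlane (bpt t) (bpt u)}.ncard ≤ M} ≤
      ∑ j ∈ Finset.range (M + 1), 2 * ∑ g ∈ Finset.Icc (z₀ / (((M * (s (j + 1) + 1) : ℕ) : ℤ) + 1))
          (z₁ / (((M * (s (j + 1) + 1) : ℕ) : ℤ) + 1)),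
        μ.real (threeArm ((((M * (s (j + 1) + 1) : ℕ) : ℤ) + 1) * g - 1) (2 * (M * (s (j + 1) + 1)) + 2)
          (s j - 1)) := by
  classical
  have hℓ0 : 0 ≤ ℓ := le_trans (by positivity) hℓ
  have hanti : Antitone s := antitone_nat_of_succ_le hs
  -- the level events, their least-anchor pieces
  set Φ : ℕ → ℤ → Set (BondConfig (Site 2)) := fun j t =>
    {ω : BondConfig (Site 2) | ∃ t' : ℤ, t ≤ t' ∧ t' ≤ t + (M * (s (j + 1) + 1) : ℕ) ∧ z₀ + ℓ ≤ t ∧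
      t' ≤ z₁ - ℓ ∧ ω ∈ openCrossing halfPlane {bpt t} F ∧ ∀ u : ℤ, z₀ ≤ u → u ≤ z₁ →
        ω ∈ openConnIn halfPlane (bpt t) (bpt u) → t ≤ u ∧ (u ≤ t' ∨ t' + ((s j : ℤ) + 1) ≤ u)} with hΦ
  set P : ℕ → ℤ → Set (BondConfig (Site 2)) := fun j t => Φ j t ∩ ⋂ (t'' : ℤ) (_ : t'' < t), (Φ j t'')ᶜ
    with hP
  set I : Finset ℤ := Finset.Icc (z₀ + ℓ) (z₁ - ℓ) with hI
  have hΦmeas : ∀ j t, MeasurableSet (Φ j t) := fun j t => measurableSet_phi _ _ _ _ _ _ _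
  have hΦdet : ∀ j t, DeterminedBy (Φ j t) Z2HalfPlane.hpEdges := fun j t => determinedBy_phi _ _ _ _ _ _ _
  have hPmeas : ∀ j t, MeasurableSet (P j t) := fun j t =>
    (hΦmeas j t).inter (MeasurableSet.iInter fun t'' => MeasurableSet.iInter fun _ => (hΦmeas j t'').compl)
  have hPdet : ∀ j t, DeterminedBy (P j t) Z2HalfPlane.hpEdges := fun j t =>
    (hΦdet j t).inter (DeterminedBy.iInter fun t'' => DeterminedBy.iInter fun _ => (hΦdet j t'').compl)
  have hΦbd : ∀ j t ω, ω ∈ Φ j t → z₀ + ℓ ≤ t ∧ t ≤ z₁ - ℓ := by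
    intro j t ω hω
    obtain ⟨t', h1', _, h3', h4', _⟩ := hω
    exact ⟨h3', by omega⟩
  -- Step 1: cover by the level events
  have hcover := bulk_subset_iUnion_phi M s hs (z₀ := z₀) (z₁ := z₁) hℓ0 F
  -- Step 2: each level event is covered by its least-anchor pieces
  have hleast : ∀ j, (⋃ t : ℤ, Φ j t) ⊆ ⋃ t ∈ I, P j t := by
    intro j ω hω
    obtain ⟨t₁, ht₁⟩ := Set.mem_iUnion.1 hω
    obtain ⟨t, ht, hmin⟩ := Int.exists_least_of_bdd (P := fun t => ω ∈ Φ j t)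
      ⟨z₀ + ℓ, fun z hz => (hΦbd j z ω hz).1⟩ ⟨t₁, ht₁⟩
    refine Set.mem_iUnion₂.2 ⟨t, ?_, ht, ?_⟩
    · rw [hI, Finset.mem_Icc]; exact hΦbd j t ω ht
    · refine Set.mem_iInter₂.2 fun t'' ht'' h => ?_
      have := hmin t'' h
      omega
  -- Step 3: the factor two for the leg
  have hleg2 : ∀ j t, μ.real (P j t) = 2 * μ.real (P j t ∩ {ω | leg t ∈ ω}) := by
    intro j t
    have h := leg_factor_half (P j t) (fun _ => t) {t} (hPmeas j t) (hPdet j t)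
      (fun _ => Finset.mem_singleton_self t) (fun k => measurableSet_setOf.2 measurable_const)
      (fun k => (determinedBy_iff _ _).2 fun _ _ _ => Iff.rfl)
    linarith
  -- Step 4: disjointness of the pieces
  have hdisj : ∀ j, (↑I : Set ℤ).PairwiseDisjoint fun t => P j t ∩ {ω | leg t ∈ ω} := by
    intro j t₁ _ t₂ _ hne
    rcases lt_or_gt_of_ne hne with hlt | hlt
    · exact Set.disjoint_left.2 fun ω h1 h2 => (Set.mem_iInter₂.1 h2.1.2 t₁ hlt) h1.1.1
    · exact Set.disjoint_left.2 fun ω h1 h2 => (Set.mem_iInter₂.1 h1.1.2 t₂ hlt) h2.1.1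
  -- Step 5: pieces with an open leg lie in the three-arm events of the grid windows (a.e.)
  have hae : ∀ᵐ ω ∂μ, ω ⊆ (zdGraph 2).edgeSet := ae_subset_edgeSet (zdGraph 2) half
  have harm : ∀ j, j ≤ M →
      μ.real (⋃ t ∈ I, (P j t ∩ {ω | leg t ∈ ω})) ≤
        μ.real (⋃ g ∈ Finset.Icc (z₀ / (((M * (s (j + 1) + 1) : ℕ) : ℤ) + 1))
            (z₁ / (((M * (s (j + 1) + 1) : ℕ) : ℤ) + 1)),
          threeArm ((((M * (s (j + 1) + 1) : ℕ) : ℤ) + 1) * g - 1) (2 * (M * (s (j + 1) + 1)) + 2)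
            (s j - 1)) := by
    intro j hj
    simp only [measureReal_def]
    refine ENNReal.toReal_mono (measure_ne_top _ _) (measure_mono_ae (hae.mono fun ω hω hmem => ?_))
    obtain ⟨t, -, ⟨hPt, hlegt⟩⟩ := Set.mem_iUnion₂.1 hmem
    have hΦt : ω ∈ Φ j t := hPt.1
    have hsj : (s j : ℤ) ≤ ℓ := le_trans (by exact_mod_cast hanti (Nat.zero_le j)) hℓ
    have hDs : ((M * (s (j + 1) + 1) : ℕ) : ℤ) + 4 ≤ (s j : ℕ) := by
      have := h1 j hj; exact_mod_cast (by omega : M * (s (j + 1) + 1) + 4 ≤ s j)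
    have key := phi_leg_subset_threeArm hiso hω (z₀ := z₀) (z₁ := z₁) (F := F) (θ := (s j : ℤ) + 1)
      hDs hsj le_rfl hF hΦt hlegt
    have hG : (0 : ℤ) < ((M * (s (j + 1) + 1) : ℕ) : ℤ) + 1 := by positivity
    obtain ⟨hb1, hb2⟩ := hΦbd j t ω hΦt
    refine Set.mem_iUnion₂.2 ⟨t / ((((M * (s (j + 1) + 1) : ℕ) : ℤ) + 1)), ?_, key⟩
    rw [Finset.mem_Icc]
    exact ⟨Int.ediv_le_ediv hG (by omega), Int.ediv_le_ediv hG (by omega)⟩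
  -- Assembly
  calc μ.real {ω : BondConfig (Site 2) | ∃ t : ℤ, z₀ + ℓ ≤ t ∧ t ≤ z₁ - ℓ ∧
          ω ∈ openCrossing halfPlane {bpt t} F ∧
          (∀ u : ℤ, z₀ ≤ u → u ≤ z₁ → ω ∈ openConnIn halfPlane (bpt t) (bpt u) → z₀ + ℓ ≤ u ∧ u ≤ z₁ - ℓ) ∧
          {u : ℤ | z₀ ≤ u ∧ u ≤ z₁ ∧ ω ∈ openConnIn halfPlane (bpt t) (bpt u)}.ncard ≤ M}
      ≤ μ.real (⋃ j ∈ Finset.range (M + 1), ⋃ t : ℤ, Φ j t) := measureReal_mono hcover (measure_ne_top _ _)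
    _ ≤ ∑ j ∈ Finset.range (M + 1), μ.real (⋃ t : ℤ, Φ j t) := measureReal_biUnion_finset_le _ _
    _ ≤ ∑ j ∈ Finset.range (M + 1), 2 * ∑ g ∈ Finset.Icc (z₀ / (((M * (s (j + 1) + 1) : ℕ) : ℤ) + 1))
          (z₁ / (((M * (s (j + 1) + 1) : ℕ) : ℤ) + 1)),
        μ.real (threeArm ((((M * (s (j + 1) + 1) : ℕ) : ℤ) + 1) * g - 1) (2 * (M * (s (j + 1) + 1)) + 2)
          (s j - 1)) := by
      refine Finset.sum_le_sum fun j hj => ?_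
      have hjM : j ≤ M := by have := Finset.mem_range.1 hj; omega
      calc μ.real (⋃ t : ℤ, Φ j t)
          ≤ μ.real (⋃ t ∈ I, P j t) := measureReal_mono (hleast j) (measure_ne_top _ _)
        _ ≤ ∑ t ∈ I, μ.real (P j t) := measureReal_biUnion_finset_le _ _
        _ = ∑ t ∈ I, 2 * μ.real (P j t ∩ {ω | leg t ∈ ω}) := Finset.sum_congr rfl fun t _ => hleg2 j t
        _ = 2 * μ.real (⋃ t ∈ I, (P j t ∩ {ω | leg t ∈ ω})) := by
          rw [← Finset.mul_sum, measureReal_biUnion_finset (hdisj j)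
            (fun t _ => (hPmeas j t).inter (measurableSet_mem _))]
        _ ≤ 2 * μ.real (⋃ g ∈ Finset.Icc (z₀ / (((M * (s (j + 1) + 1) : ℕ) : ℤ) + 1))
              (z₁ / (((M * (s (j + 1) + 1) : ℕ) : ℤ) + 1)),
            threeArm ((((M * (s (j + 1) + 1) : ℕ) : ℤ) + 1) * g - 1) (2 * (M * (s (j + 1) + 1)) + 2)
              (s j - 1)) := by
          have := harm j hjM; linarith
        _ ≤ 2 * ∑ g ∈ Finset.Icc (z₀ / (((M * (s (j + 1) + 1) : ℕ) : ℤ) + 1))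
              (z₁ / (((M * (s (j + 1) + 1) : ℕ) : ℤ) + 1)),
            μ.real (threeArm ((((M * (s (j + 1) + 1) : ℕ) : ℤ) + 1) * g - 1) (2 * (M * (s (j + 1) + 1)) + 2)
              (s j - 1)) := by
          have := measureReal_biUnion_finset_le (μ := μ)
            (Finset.Icc (z₀ / (((M * (s (j + 1) + 1) : ℕ) : ℤ) + 1)) (z₁ / (((M * (s (j + 1) + 1) : ℕ) : ℤ) + 1)))
            (fun g => threeArm ((((M * (s (j + 1) + 1) : ℕ) : ℤ) + 1) * g - 1) (2 * (M * (s (j + 1) + 1)) + 2)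
              (s j - 1))
          linarith

end Summit.CriticalPhenomena.CardyFormulaZ2.Cruxes.HalfPlaneMarkDensityLaw.SketchLine.SelfDual
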